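import Literature.NumberTheory.Automorphic.ReductiveDualLGroupProofs
import Literature.NumberTheory.Automorphic.ReductiveDualChevalleyExistenceProofs
import Literature.NumberTheory.Automorphic.ChevalleyIsomorphismOfAbstract
import Literature.NumberTheory.Automorphic.ReductiveDualAbstractIsomorphism
import HarnessLib

/-!
# The L-group exists (lang.S13 (d)): `exists_dualGroupStr` from step 1 of the isomorphism theorem alone

Assembly file for `Literature.NumberTheory.Automorphic.exists_dualGroupStr` (`ReductiveDual.lean`,
item (d); Borel, *Automorphic L-functions*, Corvallis 1979, §I.2 (2.1)–(2.4): for a reduced based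
root datum `(P, b)` with a Galois action `a : Γ_F → Aut(P, b)` with open kernel there is an L-group
datum `L`, `ᴸG = Ĝ ⋊ Γ_F`, with a dual group structure `D : L.DualGroupStr P b` whose action on the
root datum is `a`). `ReductiveDualLGroupProofs.lean` proved Borel's construction
(`exists_dualGroupStr_of_chevalley`): the fact follows from Chevalley's existence theorem
`chevalley_existence` (Springer 10.1.1) and the isomorphism theorem `chevalley_isomorphism`
(Springer 9.6.2 / 16.3.2), both at `k = ℂ`. Since then

* `chevalley_existence` has been **proved** (`chevalley_existence_holds`,
  `ReductiveDualChevalleyExistenceProofs.lean`: Chevalley system, highest weight modules, the group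
  `⟨T_X, exp (x E_α)⟩`), and
* `chevalley_isomorphism` has been reduced to step 1 of Springer's proof of 9.6.2 alone
  (`chevalley_isomorphism_of_abstract`, `ChevalleyIsomorphismOfAbstract.lean`: the isomorphism of
  abstract groups inducing the identity of the root datum, `chevalley_isomorphism_abstract`; step 2 —
  8.1.1 (i), 8.2.1, 8.3.11 and the algebraicity on the translates of the big cell — is proved).

Hence:

* **`exists_dualGroupStr_of_abstract`** — `(∀ N G T, chevalley_isomorphism_abstract ℂ (G, T) (G, T))
  → exists_dualGroupStr`: the named fact `chevalley_isomorphism_abstract` (Springer 9.6.2, step 1: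
  the presentation 9.4.3 with 9.5.4), for equal data `(G', T') = (G, T)` over `ℂ`, is the whole
  remaining trust base of lang.S13 (d).

* **`exists_dualGroupStr_holds : exists_dualGroupStr`** — the discharge: step 1 has since been
  **proved** (`chevalley_isomorphism_abstract_holds`, `ReductiveDualAbstractIsomorphism.lean`, the
  graph method of Chevalley / Humphreys §33 on the Lie algebra in characteristic `0`), so Borel's
  theorem (lang.S13 (d)) now holds unconditionally.

No definition and no named fact is introduced; nothing is assumed.

## References

* [BorelCorvallis1979] A. Borel, *Automorphic L-functions*, Proc. Sympos. Pure Math. 33 (2), AMS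
  (1979), 27–61: §I.2 (2.1)–(2.4).
* [SpringerLAG1998] T. A. Springer, *Linear Algebraic Groups*, 2nd ed., Progress in Mathematics 9,
  Birkhäuser (1998): Thm 9.6.2 and its proof, Thm 10.1.1, 16.3.2–16.3.3.
* K. Buzzard, T. Gee, *The conjectural connections between automorphic representations and Galois
  representations*, in: Automorphic forms and Galois representations I, LMS LNS 414 (2014), §2.1.
-/

open scoped MatrixGroups IsMulCommutative

namespace Literature.NumberTheory.Automorphic

variable {F : Type*} [Field F]
variable {ι X Y : Type*} [AddCommGroup X] [AddCommGroup Y]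

/-- **lang.S13 (d) from step 1 of the isomorphism theorem alone** (Borel, Corvallis 1979, §I.2).
Granted, over `ℂ` and for equal data `(G', T') = (G, T)`, the abstract isomorphism of step 1 of
Springer's proof of 9.6.2 (`chevalley_isomorphism_abstract`: connected reductive groups with
maximal tori realizing the same root datum are isomorphic as abstract groups, compatibly with the
tori, the characters and the root homomorphisms), the named fact `exists_dualGroupStr` holds: the
isomorphism theorem `chevalley_isomorphism` follows from step 1 (`chevalley_isomorphism_of_abstract`),
Chevalley's existence theorem is `chevalley_existence_holds ℂ`, and Borel's construction of
`ᴸG = Ĝ ⋊ Γ_F` from these two theorems is `exists_dualGroupStr_of_chevalley`.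
[cite: BorelCorvallis1979, §I.2 (2.1)–(2.4)] -/
theorem exists_dualGroupStr_of_abstract
    (hA : ∀ {N : ℕ} {G T : Subgroup (GL (Fin N) ℂ)} [IsMulCommutative ↥T],
      chevalley_isomorphism_abstract (k := ℂ) (ι := ι) (X := Y) (Y := X) (G := G) (T := T)
        (G' := G) (T' := T)) :
    exists_dualGroupStr (F := F) (ι := ι) (X := X) (Y := Y) :=
  exists_dualGroupStr_of_chevalley (chevalley_existence_holds ℂ)
    (@fun _ _ _ _ => chevalley_isomorphism_of_abstract hA)

/-- **Borel, Corvallis 1979, §I.2: the L-group exists (lang.S13 (d)), discharged.** For every reduced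
based root datum `(P, b)` with a continuous action `a : Γ_F → Aut(P, b)` (open kernel) there is an
L-group datum `L` over `F`, `ᴸG = Ĝ ⋊ Γ_F` with `Ĝ ≤ GL_N(ℂ)` connected reductive, and a dual group
structure `D : L.DualGroupStr P b` (maximal torus, Borel subgroup and pinning of `Ĝ` realizing the
dual based root datum `(P^∨, b^∨)`, all stable under the algebraic Galois action) whose induced action
on the root datum is `a`. Proof: Borel's construction `exists_dualGroupStr_of_chevalley` from
Chevalley's existence theorem (`chevalley_existence_holds ℂ`, Springer 10.1.1) and the isomorphism
theorem (Springer 9.6.2: step 1 `chevalley_isomorphism_abstract_holds`, step 2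
`chevalley_isomorphism_of_abstract`), packaged as `exists_dualGroupStr_of_abstract`.
[cite: BorelCorvallis1979, §I.2 (2.1)–(2.4)] -/
theorem exists_dualGroupStr_holds : exists_dualGroupStr (F := F) (ι := ι) (X := X) (Y := Y) :=
  exists_dualGroupStr_of_abstract (@fun _ _ _ _ => chevalley_isomorphism_abstract_holds)

end Literature.NumberTheory.Automorphic
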